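import Literature.Computability.MetaComplexity.FunctionalPigeonholeDegreeProof
import HarnessLib

/-!
# Degree lower bounds for the graph (onto) pigeonhole principle (Mikša–Nordström 2015, Thm 4.5; Alekhnovich–Razborov), proved

Mikša–Nordström, CCC 2015 Thm 4.5 (= arXiv:1505.01358 Thm 38), reproving and extending
Alekhnovich–Razborov: if the bipartite graph `G` (left neighbourhoods `N : Fin m → Finset (Fin n)`)
has matchings for all sets of `≤ s` pigeons and `|∂(U')| ≥ δ|U'| - ξ` for `|U'| ≤ s`, then the graph
ONTO pigeonhole principle `Onto-PHP_G` (pigeon axioms (4.2a), hole axioms (4.2b), onto axioms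
(4.2d)) needs PC degree `> δs/2 - ξ` ("observe that the lower bound in [AR03] works also for the
onto version").  The structure of MN15's proof sketch: `𝓕` = pigeon axioms, `E` = hole + onto
axioms, `V_v = {x_{u,v} : u ∈ N⁻¹(v)}` (a partition, overlap `1`), respectful neighbours "apply
the partial assignment sending pigeon `u` to hole `v` and ruling out all other pigeons in
`N(v) ∖ {u}`".  Here (in the namespace `FPHP` of the sibling files):

* `ontoClause`, `ontoClauses`, `ontoPhpCNF N` (= `Onto-PHP_G`), `phpCNF N` (= `PHP_G`, (4.2a)–(4.2b));
* the structure (`ontoE`, `colSet`), `colSet_respects` (needs a pigeon for every hole: send it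
  there), `isRespNbr_col`, `isRespExpander_col`, overlap `1`, and `locSol_onto_nonempty` (a system of
  distinct representatives for the pigeons of `S`, every other hole filled by some pigeon);
* **`not_refutableInDegree_ontoPhpCNF`**: `s ≥ 2`, `δ > 0` (any real slack `ξ`), every hole has a pigeon,
  SDR matchings for `≤ s` pigeons, `δ|U'| - ξ ≤ |∂U'|` for `|U'| ≤ s` ⇒ no PC refutation of
  `Onto-PHP_G` of degree `≤ D ≤ (δs - 2ξ)/2`, any field; **`not_refutableInDegree_phpCNF`**: the same
  for the sub-CNF `PHP_G` over an `(s, δ)`-boundary expander (slack `0`; matchings then come from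
  expansion, `exists_sdr`) — Alekhnovich–Razborov's graph-PHP bound `> δs/2`.

Source: M. Mikša, J. Nordström, CCC 2015 (LIPIcs 33) Thm 4.5 and its proof sketch, §4.2 (4.2a)–(4.2d)
= arXiv:1505.01358 Thm 38 [MiksaNordstrom2015] (held copy `paper:arxiv-1505.01358` p0021: Thm 38 L101–L121, proof sketch L123–L150); the
original bound: M. Alekhnovich, A. Razborov, FOCS 2001 [AlekhnovichRazborov2001].  Hypotheses made
explicit: `2 ≤ s`; every hole has a pigeon (otherwise an onto axiom is the empty clause).
-/

noncomputable section

namespace Literature.Computability.MetaComplexity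

open Finset MvPolynomial Literature.Computability.Complexity PCResidue MiksaNordstrom

namespace FPHP

variable {m n : ℕ} (N : Fin m → Finset (Fin n))

/-! ### `PHP_G` and `Onto-PHP_G` -/

/-- Onto axiom (4.2d) at hole `v`: `⋁_{u ∈ N⁻¹(v)} x_{u,v}` (pigeons in increasing order).
[Mikša–Nordström 2015, (4.2d)] [cite: MiksaNordstrom2015, §4.2] -/
def ontoClause (v : Fin n) : Clause ℕ :=
  ((Finset.univ.filter fun u : Fin m => v ∈ N u).sort (· ≤ ·)).map fun u => (var n u v, true)

/-- All onto axioms. [Mikša–Nordström 2015, (4.2d)] [cite: MiksaNordstrom2015, §4.2] -/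
def ontoClauses : CNF ℕ := (List.finRange n).map (ontoClause N)

/-- **`PHP_G`**: pigeon axioms (4.2a) and hole axioms (4.2b) ("the plain vanilla graph pigeonhole
principle formula"). [Mikša–Nordström 2015, §4.2] [cite: MiksaNordstrom2015, §4.2] -/
def phpCNF : CNF ℕ := (List.finRange m).map (pigeonClause N) ++ holeClauses N

/-- **`Onto-PHP_G`**: `PHP_G` plus the onto axioms (4.2d). [Mikša–Nordström 2015, §4.2]
[cite: MiksaNordstrom2015, §4.2] -/
def ontoPhpCNF : CNF ℕ := phpCNF N ++ ontoClauses N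

/-- `E` of the structure: hole and onto axioms. [Mikša–Nordström 2015, proof of Thm 4.5 ("E to
consist of the hole axioms and onto axioms")] [cite: MiksaNordstrom2015, Theorem 4.5] -/
def ontoE : CNF ℕ := holeClauses N ++ ontoClauses N

/-- `V_v = {x_{u,v} : u ∈ N⁻¹(v)}` ("partitioned with respect to the holes"). [Mikša–Nordström 2015,
proof of Thm 4.5] [cite: MiksaNordstrom2015, Theorem 4.5] -/
def colSet : Fin n → Finset ℕ := fun v => (Finset.univ.filter fun u : Fin m => v ∈ N u).image
  fun u => var n u v

variable {N}

/-- Membership in `V_v`. [Mikša–Nordström 2015, proof of Thm 4.5] [cite: MiksaNordstrom2015, Theorem 4.5] -/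
theorem mem_colSet {v : Fin n} {x : ℕ} : x ∈ colSet N v ↔ ∃ u, v ∈ N u ∧ var n u v = x := by
  simp [colSet]

/-- Membership in an onto axiom. [Mikša–Nordström 2015, (4.2d)] [cite: MiksaNordstrom2015, §4.2] -/
theorem mem_ontoClause {v : Fin n} {l : Literal ℕ} :
    l ∈ ontoClause N v ↔ ∃ u, v ∈ N u ∧ (var n u v, true) = l := by
  simp [ontoClause]

/-- Every clause of `E` is a hole axiom or an onto axiom. [Mikša–Nordström 2015, proof of Thm 4.5]
[cite: MiksaNordstrom2015, Theorem 4.5] -/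
theorem mem_ontoE {C : Clause ℕ} (hC : C ∈ ontoE N) :
    (∃ v u u', u < u' ∧ v ∈ N u ∧ v ∈ N u' ∧ C = [(var n u v, false), (var n u' v, false)]) ∨
      ∃ v, C = ontoClause N v := by
  rcases List.mem_append.1 hC with h | h
  · exact Or.inl (mem_holeClauses.1 h)
  · obtain ⟨v, -, rfl⟩ := List.mem_map.1 h
    exact Or.inr ⟨v, rfl⟩

/-- The assignment "pigeon `u` sits in hole `v`, nobody else does" on `V_v` respects `E`: every
hole axiom at `v` gets a false variable, the onto axiom at `v` the true one, and no other clause of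
`E` is touched. [Mikša–Nordström 2015, proof of Thm 4.5 ("sending pigeon u to hole v and ruling out
all other pigeons in N(v) ∖ {u}")] [cite: MiksaNordstrom2015, Theorem 4.5] -/
theorem respects_send {u : Fin m} {v : Fin n} (huv : v ∈ N u) :
    Respects (colSet N v) (fun x => decide (x = var n u v)) (ontoE N) := by
  classical
  intro C hC ht
  obtain ⟨l, hl, hlV⟩ := ht
  obtain ⟨u₀, hu₀, hx₀⟩ := mem_colSet.1 hlV
  rcases mem_ontoE hC with ⟨v', u₁, u₂, h12, h₁, h₂, rfl⟩ | ⟨v', rfl⟩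
  · -- a hole axiom; it is at hole `v` since it is touched by `V_v`
    simp only [List.mem_cons, List.not_mem_nil, or_false] at hl
    have hv' : v' = v := by
      rcases hl with rfl | rfl <;> exact (var_inj hx₀).2.symm ▸ rfl
    subst hv'
    -- one of `u₁, u₂` differs from `u`; its variable is in `V_v` and is set to false
    by_cases h1 : u₁ = u
    · have h2 : u₂ ≠ u := fun h => h12.ne (h1.trans h.symm)
      refine ⟨(var n u₂ v', false), by simp, mem_colSet.2 ⟨u₂, h₂, rfl⟩, ?_⟩
      have : var n u₂ v' ≠ var n u v' := fun h => h2 (var_inj h).1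
      simp [this]
    · refine ⟨(var n u₁ v', false), by simp, mem_colSet.2 ⟨u₁, h₁, rfl⟩, ?_⟩
      have : var n u₁ v' ≠ var n u v' := fun h => h1 (var_inj h).1
      simp [this]
  · -- an onto axiom; it is at hole `v`, and `x_{u,v}` satisfies it
    obtain ⟨u₁, hu₁, rfl⟩ := mem_ontoClause.1 hl
    have hv' : v' = v := (var_inj hx₀).2.symm ▸ rfl
    subst hv'
    exact ⟨(var n u v', true), mem_ontoClause.2 ⟨u, huv, rfl⟩, mem_colSet.2 ⟨u, huv, rfl⟩, by simp⟩

/-- Every `V_v` respects `E`, provided hole `v` has a pigeon. [Mikša–Nordström 2015, proof of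
Thm 4.5] [cite: MiksaNordstrom2015, Theorem 4.5] -/
theorem colSet_respects (hV : ∀ v, ∃ u, v ∈ N u) (v : Fin n) :
    ∃ a, Respects (colSet N v) a (ontoE N) := by
  obtain ⟨u, huv⟩ := hV v
  exact ⟨_, respects_send huv⟩

/-- `V_k` is a neighbour of `P^u` iff `k ∈ N(u)`. [Mikša–Nordström 2015, proof of Thm 4.5 ("this
structure is isomorphic to the graph G")] [cite: MiksaNordstrom2015, Theorem 4.5] -/
theorem isNbr_col_iff {u : Fin m} {k : Fin n} : IsNbr (fam N) (colSet N) u k ↔ k ∈ N u := by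
  constructor
  · rintro ⟨C, hC, l, hl, hlV⟩
    rw [fam, List.mem_singleton] at hC
    subst hC
    obtain ⟨v, hv, rfl⟩ := mem_pigeonClause.1 hl
    obtain ⟨u', hk, heq⟩ := mem_colSet.1 hlV
    obtain ⟨rfl, rfl⟩ := var_inj heq
    exact hv
  · intro hk
    exact ⟨pigeonClause N u, by simp [fam], (var n u k, true), mem_pigeonClause.2 ⟨k, hk, rfl⟩,
      mem_colSet.2 ⟨u, hk, rfl⟩⟩

/-- **Respectful neighbours**: for `k ∈ N(u)`, sending `u` to `k` and ruling out the other pigeons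
of `k` respectfully satisfies `P^u`. [Mikša–Nordström 2015, proof of Thm 4.5]
[cite: MiksaNordstrom2015, Theorem 4.5] -/
theorem isRespNbr_col {u : Fin m} {k : Fin n} (hk : k ∈ N u) :
    IsRespNbr (fam N) (colSet N) (ontoE N) u k := by
  refine ⟨isNbr_col_iff.2 hk, fun x => decide (x = var n u k), fun C hC => ?_, respects_send hk⟩
  rw [fam, List.mem_singleton] at hC
  subst hC
  exact ⟨(var n u k, true), mem_pigeonClause.2 ⟨k, hk, rfl⟩, mem_colSet.2 ⟨u, hk, rfl⟩, by simp⟩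

/-- **Expansion with slack transfers** to respectful boundary expansion of the structure.
[Mikša–Nordström 2015, proof of Thm 4.5] [cite: MiksaNordstrom2015, Theorem 4.5] -/
theorem isRespExpander_col {s δ ξ : ℝ}
    (hG : ∀ S : Finset (Fin m), (S.card : ℝ) ≤ s →
      δ * S.card - ξ ≤ ((boundary (holeScope N) S).card : ℝ)) :
    IsRespExpander (fam N) (colSet N) (ontoE N) s δ ξ := by
  classical
  intro S hS
  refine (hG S hS).trans ?_
  have hsub : boundary (holeScope N) S ⊆
      (respBoundary (fam N) (colSet N) (ontoE N) S).map Fin.valEmbedding := by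
    intro x hx
    obtain ⟨hcov, hdeg⟩ := mem_boundary.1 hx
    obtain ⟨u, hu, hxu⟩ := mem_cover.1 hcov
    obtain ⟨k, hk, rfl⟩ := mem_holeScope.1 hxu
    rw [coverDegree, Finset.card_eq_one] at hdeg
    obtain ⟨u₀, hu₀⟩ := hdeg
    have huniq : ∀ u' ∈ S, k ∈ N u' → u' = u := fun u' hu' hk' => by
      have h1 : u' ∈ ({u₀} : Finset (Fin m)) := by
        rw [← hu₀]; exact Finset.mem_filter.2 ⟨hu', mem_holeScope.2 ⟨k, hk', rfl⟩⟩
      have h2 : u ∈ ({u₀} : Finset (Fin m)) := by rw [← hu₀]; exact Finset.mem_filter.2 ⟨hu, hxu⟩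
      rw [Finset.mem_singleton.1 h1, Finset.mem_singleton.1 h2]
    refine Finset.mem_map.2 ⟨k, mem_respBoundary.2 ⟨u, hu, isRespNbr_col hk,
      fun u' hu' hne hn => hne (huniq u' hu' (isNbr_col_iff.1 hn))⟩, rfl⟩
  exact_mod_cast (Finset.card_le_card hsub).trans (Finset.card_map _).le

/-- Overlap `1`: the `V_v` are pairwise disjoint. [Mikša–Nordström 2015, proof of Thm 4.5
("partitioned with respect to the holes")] [cite: MiksaNordstrom2015, Theorem 4.5] -/
theorem overlap_col (x : ℕ) : (Finset.univ.filter fun k => x ∈ colSet N k).card ≤ 1 := by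
  classical
  refine Finset.card_le_one.2 fun a ha b hb => ?_
  obtain ⟨u₁, -, h₁⟩ := mem_colSet.1 (Finset.mem_filter.1 ha).2
  obtain ⟨u₂, -, h₂⟩ := mem_colSet.1 (Finset.mem_filter.1 hb).2
  exact (var_inj (h₁.trans h₂.symm)).2

/-- **Small subfamilies are satisfiable** together with all hole and onto axioms: match the
pigeons of `S` injectively (`M`), and put into every unused hole one of its pigeons.
[Mikša–Nordström 2015, proof of Thm 4.5 ("using the existence of matchings … every subformula
F' ∧ E is satisfiable")] [cite: MiksaNordstrom2015, Theorem 4.5] -/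
theorem locSol_onto_nonempty (hV : ∀ v, ∃ u, v ∈ N u) {S : Finset (Fin m)} {M : Fin m → ℕ}
    (hM : ∀ u ∈ S, ∃ v ∈ N u, M u = v.val) (hinj : Set.InjOn M S) :
    (locSol (fam N) (ontoE N) S).Nonempty := by
  classical
  choose c hc using hV
  -- hole `v` is "matched" if some pigeon of `S` is sent to it
  let matched : Fin n → Prop := fun v => ∃ u ∈ S, M u = v.val
  let x : ℕ → Bool := fun j => decide (∃ u v, var n u v = j ∧
    ((u ∈ S ∧ M u = v.val) ∨ (¬ matched v ∧ u = c v)))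
  have hx : ∀ (u : Fin m) (v : Fin n),
      x (var n u v) = true ↔ (u ∈ S ∧ M u = v.val) ∨ (¬ matched v ∧ u = c v) := by
    intro u v
    simp only [x, decide_eq_true_eq]
    constructor
    · rintro ⟨u', v', heq, h⟩
      obtain ⟨rfl, rfl⟩ := var_inj heq
      exact h
    · exact fun h => ⟨u, v, rfl, h⟩
  -- at most one pigeon per hole
  have huniq : ∀ (v : Fin n) (u₁ u₂ : Fin m), x (var n u₁ v) = true → x (var n u₂ v) = true →
      u₁ = u₂ := by
    intro v u₁ u₂ h₁ h₂
    rcases (hx u₁ v).1 h₁ with ⟨hS₁, hM₁⟩ | ⟨hm₁, rfl⟩ <;>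
      rcases (hx u₂ v).1 h₂ with ⟨hS₂, hM₂⟩ | ⟨hm₂, h⟩
    · exact hinj hS₁ hS₂ (hM₁.trans hM₂.symm)
    · exact absurd ⟨u₁, hS₁, hM₁⟩ hm₂
    · exact absurd ⟨u₂, hS₂, hM₂⟩ hm₁
    · exact h.symm
  refine ⟨x, fun C hC => ?_, fun u hu C hC => ?_⟩
  · rcases mem_ontoE hC with ⟨v, u₁, u₂, h12, -, -, rfl⟩ | ⟨v, rfl⟩
    · -- hole axiom
      simp only [Clause.eval, List.any_cons, List.any_nil, Bool.or_false, Literal.eval,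
        Bool.or_eq_true, beq_iff_eq]
      by_contra hcon
      rw [not_or] at hcon
      have t₁ : x (var n u₁ v) = true := by
        cases hb : x (var n u₁ v) with
        | false => exact absurd hb hcon.1
        | true => rfl
      have t₂ : x (var n u₂ v) = true := by
        cases hb : x (var n u₂ v) with
        | false => exact absurd hb hcon.2
        | true => rfl
      exact h12.ne (huniq v u₁ u₂ t₁ t₂)
    · -- onto axiom at `v`
      simp only [Clause.eval, List.any_eq_true]
      by_cases hm : matched v
      · obtain ⟨u, hu, hMu⟩ := hm
        obtain ⟨v', hv', hMv'⟩ := hM u hu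
        have hvv' : v' = v := Fin.ext (hMv'.symm.trans hMu)
        subst hvv'
        exact ⟨(var n u v', true), mem_ontoClause.2 ⟨u, hv', rfl⟩, by
          rw [Literal.eval, (hx u v').2 (Or.inl ⟨hu, hMu⟩)]; rfl⟩
      · exact ⟨(var n (c v) v, true), mem_ontoClause.2 ⟨c v, hc v, rfl⟩, by
          rw [Literal.eval, (hx (c v) v).2 (Or.inr ⟨hm, rfl⟩)]; rfl⟩
  · rw [fam, List.mem_singleton] at hC
    subst hC
    obtain ⟨v, hv, hMv⟩ := hM u hu
    simp only [Clause.eval, List.any_eq_true]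
    exact ⟨(var n u v, true), mem_pigeonClause.2 ⟨v, hv, rfl⟩, by
      rw [Literal.eval, (hx u v).2 (Or.inl ⟨hu, hMv⟩)]; rfl⟩

/-- Clauses of `Onto-PHP_G` are clauses of `E` or pigeon axioms. [Mikša–Nordström 2015, §4.2]
[cite: MiksaNordstrom2015, §4.2] -/
theorem mem_ontoPhpCNF_cases {C : Clause ℕ} (hC : C ∈ ontoPhpCNF N) :
    C ∈ ontoE N ∨ ∃ u, C ∈ fam N u := by
  rcases List.mem_append.1 hC with hC | hC
  · rcases List.mem_append.1 hC with hC | hC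
    · obtain ⟨u, -, rfl⟩ := List.mem_map.1 hC
      exact Or.inr ⟨u, by simp [fam]⟩
    · exact Or.inl (List.mem_append.2 (Or.inl hC))
  · exact Or.inl (List.mem_append.2 (Or.inr hC))

/-- **Mikša–Nordström's Theorem 4.5 (Alekhnovich–Razborov's bound, onto version), proved**: if every
hole has a pigeon, every set of `≤ s` pigeons has a system of distinct representative holes, and
`δ|U'| - ξ ≤ |∂U'|` for `|U'| ≤ s` (`s ≥ 2`, `δ > 0`), then `Onto-PHP_G` has no PC refutation of
degree `≤ D` for `D ≤ (δs - 2ξ)/2`, over any field ("deg(Onto-PHP_G) > δs/2 − ξ").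
[Mikša–Nordström 2015, Thm 4.5] [cite: MiksaNordstrom2015, Theorem 4.5] -/
theorem not_refutableInDegree_ontoPhpCNF {K : Type*} [Field K] {s δ ξ : ℝ} (hs : 2 ≤ s)
    (hδ : 0 < δ) (hV : ∀ v, ∃ u, v ∈ N u)
    (hmatch : ∀ S : Finset (Fin m), (S.card : ℝ) ≤ s →
      ∃ M : Fin m → ℕ, (∀ u ∈ S, ∃ v ∈ N u, M u = v.val) ∧ Set.InjOn M S)
    (hG : ∀ S : Finset (Fin m), (S.card : ℝ) ≤ s →
      δ * S.card - ξ ≤ ((boundary (holeScope N) S).card : ℝ))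
    {D : ℕ} (hD : (D : ℝ) ≤ (δ * s - 2 * ξ) / 2) :
    ¬ PC.RefutableInDegree (PC.ofCNF K (ontoPhpCNF N)) D := by
  refine MiksaNordstrom.not_refutableInDegree (𝓕 := fam N) (𝒱 := colSet N) (E := ontoE N)
    (ℓ := 1) (isRespExpander_col hG) hδ hs (colSet_respects hV) le_rfl overlap_col
    (fun S hS => ?_) (fun C hC => mem_ontoPhpCNF_cases hC) (by rwa [Nat.cast_one, mul_one])
  obtain ⟨M, hM, hinj⟩ := hmatch S hS
  exact locSol_onto_nonempty hV hM hinj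

/-- **Alekhnovich–Razborov's degree lower bound for the graph pigeonhole principle, proved**: over a
bipartite `(s, δ)`-boundary expander (`s ≥ 2`, `δ > 0`) the CNF `PHP_G` (pigeon and hole axioms)
has no PC refutation of degree `≤ D ≤ δs/2`, over any field ("good bipartite boundary expanders G
yield formulas PHP_G that require large polynomial calculus degree", degree `> δs/2`; matchings come
from expansion, and the onto axioms at pigeonless holes are never used). [Mikša–Nordström 2015,
Thm 4.5 (slack `0`) after Alekhnovich–Razborov 2001/2003] [cite: MiksaNordstrom2015, Theorem 4.5] -/
theorem not_refutableInDegree_phpCNF {K : Type*} [Field K] {s δ : ℝ} (hs : 2 ≤ s) (hδ : 0 < δ)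
    (hG : IsBoundaryExpander (holeScope N) s δ) {D : ℕ} (hD : (D : ℝ) ≤ δ * s / 2) :
    ¬ PC.RefutableInDegree (PC.ofCNF K (phpCNF N)) D := by
  classical
  -- drop the pigeonless holes: restrict to the structure with `E` = hole axioms only, where every
  -- `V_v` respects `E` by the all-false assignment; we realise this by the general theorem with
  -- `E := holeClauses N` directly.
  refine MiksaNordstrom.not_refutableInDegree (𝓕 := fam N) (𝒱 := colSet N) (E := holeClauses N)
    (ξ := 0) (ℓ := 1) (fun S hS => ?_) hδ hs (fun v => ⟨fun _ => false, fun C hC ht => ?_⟩) le_rfl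
    overlap_col (fun S hS => ?_) (fun C hC => ?_) (by rwa [mul_zero, sub_zero, Nat.cast_one, mul_one])
  · -- respectful expansion (the respectful neighbours only need the hole axioms)
    rw [sub_zero]
    refine (hG S hS).trans ?_
    have hsub : boundary (holeScope N) S ⊆
        (respBoundary (fam N) (colSet N) (holeClauses N) S).map Fin.valEmbedding := by
      intro x hx
      obtain ⟨hcov, hdeg⟩ := mem_boundary.1 hx
      obtain ⟨u, hu, hxu⟩ := mem_cover.1 hcov
      obtain ⟨k, hk, rfl⟩ := mem_holeScope.1 hxu
      rw [coverDegree, Finset.card_eq_one] at hdeg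
      obtain ⟨u₀, hu₀⟩ := hdeg
      have huniq : ∀ u' ∈ S, k ∈ N u' → u' = u := fun u' hu' hk' => by
        have h1 : u' ∈ ({u₀} : Finset (Fin m)) := by
          rw [← hu₀]; exact Finset.mem_filter.2 ⟨hu', mem_holeScope.2 ⟨k, hk', rfl⟩⟩
        have h2 : u ∈ ({u₀} : Finset (Fin m)) := by rw [← hu₀]; exact Finset.mem_filter.2 ⟨hu, hxu⟩
        rw [Finset.mem_singleton.1 h1, Finset.mem_singleton.1 h2]
      have hresp : IsRespNbr (fam N) (colSet N) (holeClauses N) u k := by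
        refine ⟨isNbr_col_iff.2 hk, fun x => decide (x = var n u k), fun C hC => ?_, fun C hC ht =>
          respects_send hk C (List.mem_append.2 (Or.inl hC)) ht⟩
        rw [fam, List.mem_singleton] at hC
        subst hC
        exact ⟨(var n u k, true), mem_pigeonClause.2 ⟨k, hk, rfl⟩, mem_colSet.2 ⟨u, hk, rfl⟩, by simp⟩
      refine Finset.mem_map.2 ⟨k, mem_respBoundary.2 ⟨u, hu, hresp,
        fun u' hu' hne hn => hne (huniq u' hu' (isNbr_col_iff.1 hn))⟩, rfl⟩
    exact_mod_cast (Finset.card_le_card hsub).trans (Finset.card_map _).le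
  · -- all-false respects the hole axioms
    obtain ⟨l, hl, hlV⟩ := ht
    obtain ⟨v', u₁, u₂, -, -, -, rfl⟩ := mem_holeClauses.1 hC
    refine ⟨l, hl, hlV, ?_⟩
    simp only [List.mem_cons, List.not_mem_nil, or_false] at hl
    rcases hl with rfl | rfl <;> rfl
  · -- satisfiability: a model of the onto-structure is a model of the hole axioms
    obtain ⟨M, hM, hinj⟩ := exists_sdr hG hδ S hS
    -- build the assignment directly: pigeons of `S` on their representatives, everything else false
    let x : ℕ → Bool := fun j => decide (∃ u ∈ S, ∃ v ∈ N u, M u = v.val ∧ var n u v = j)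
    have hx : ∀ (u : Fin m) (v : Fin n), v ∈ N u → (x (var n u v) = true ↔ u ∈ S ∧ M u = v.val) := by
      intro u v hv
      simp only [x, decide_eq_true_eq]
      constructor
      · rintro ⟨u', hu', v', -, hM', heq⟩
        obtain ⟨rfl, rfl⟩ := var_inj heq
        exact ⟨hu', hM'⟩
      · rintro ⟨hu, hMu⟩
        exact ⟨u, hu, v, hv, hMu, rfl⟩
    refine ⟨x, fun C hC => ?_, fun u hu C hC => ?_⟩
    · obtain ⟨v, u₁, u₂, h12, h₁, h₂, rfl⟩ := mem_holeClauses.1 hC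
      simp only [Clause.eval, List.any_cons, List.any_nil, Bool.or_false, Literal.eval,
        Bool.or_eq_true, beq_iff_eq]
      by_contra hcon
      rw [not_or] at hcon
      have t₁ : x (var n u₁ v) = true := by
        cases hb : x (var n u₁ v) with
        | false => exact absurd hb hcon.1
        | true => rfl
      have t₂ : x (var n u₂ v) = true := by
        cases hb : x (var n u₂ v) with
        | false => exact absurd hb hcon.2
        | true => rfl
      obtain ⟨hS₁, hM₁⟩ := (hx u₁ v h₁).1 t₁
      obtain ⟨hS₂, hM₂⟩ := (hx u₂ v h₂).1 t₂
      exact h12.ne (hinj hS₁ hS₂ (hM₁.trans hM₂.symm))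
    · rw [fam, List.mem_singleton] at hC
      subst hC
      obtain ⟨v, hv, hMv⟩ := hM u hu
      simp only [Clause.eval, List.any_eq_true]
      exact ⟨(var n u v, true), mem_pigeonClause.2 ⟨v, hv, rfl⟩, by
        rw [Literal.eval, (hx u v hv).2 ⟨hu, hMv⟩]; rfl⟩
  · rcases List.mem_append.1 hC with hC | hC
    · obtain ⟨u, -, rfl⟩ := List.mem_map.1 hC
      exact Or.inr ⟨u, by simp [fam]⟩
    · exact Or.inl hC

end FPHP

end Literature.Computability.MetaComplexity
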